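import Mathlib
import HarnessLib
import Summits.RiemannHypothesis.RiemannHypothesis.Theses.SpectralTrace
import Literature.NumberTheory.LFunctions.WeilExplicit

/-!
# Sketch — crux-ideate stmt-RiemannHypothesis-0187 (X = `SpectralTrace.SpectralThesis`), round 1, ideator 3

First lemmas of the two idea cards `prime-spectrogram` and `energy-local-operator-criterion`.
Statements only (sorried); they must ELABORATE. Nothing here is a route item.
-/

noncomputable section

namespace Summit.RiemannHypothesis.RiemannHypothesis.Cruxes.SpectralThesis.Ideator3

open Literature.NumberTheory.LFunctions Complex MeasureTheory Set Filter Topology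

/-- Gabor atom: the window `t ↦ k(t/a)` modulated to frequency `T`, i.e. `t ↦ k(t/a) e^{iTt}`.
For `k = h ⋆ h̃` it is the Weil square `g ⋆ g̃` of `g = h_a e^{iT·}`, `h_a(t) = a^{-1/2} h(t/a)`. -/
def gaborAtom (k : ℝ → ℂ) (a T : ℝ) : ℝ → ℂ :=
  fun t => k (t / a) * cexp ((T * t : ℝ) * I)

/-- The PRIME SPECTROGRAM `P_k(a,T) := W(k(·/a) e^{iT·})`: by `weilFunctional` it is
`2 Re K_a(T + i/2)` (polar) `+ arch_a(T)` `− 2 Σ_{n} Λ(n) n^{-1/2} k(log n / a) cos(T log n)`,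
a finite prime sum (n < e^{a r} if supp k ⊆ [-r, r]). Under RH it equals `Σ_γ m_γ K_a(γ + T) ≥ 0`. -/
def primeSpectrogram (k : ℝ → ℂ) (a T : ℝ) : ℂ :=
  weilFunctional (gaborAtom k a T)

/-- Admissible window: `k = h ⋆ h̃` for a Weil test `h`, normalised `k 0 = 1`, supported in `[-r, r]`
and non-vanishing on `(-r, r)` (e.g. `h ≥ 0` smooth bump on `[-r/2, r/2]`). -/
def IsWindow (k : ℝ → ℂ) (r : ℝ) : Prop :=
  (∃ h : ℝ → ℂ, IsWeilTest h ∧ k = weilConv h (weilReflect h)) ∧ k 0 = 1 ∧ 0 < r ∧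
    tsupport k ⊆ Icc (-r) r ∧ ∀ t ∈ Ioo (-r) r, k t ≠ 0

/-- **Spectrogram positivity** (the transfer C⁺ of card `prime-spectrogram`): the explicit
two-variable prime expression `P_k(a,T)` is non-negative at every scale `a ≥ 1` and frequency `T`. -/
def SpectrogramPositivity (k : ℝ → ℂ) : Prop :=
  ∀ a T : ℝ, 1 ≤ a → 0 ≤ (primeSpectrogram k a T).re

/-- **Superposition identity** (first lemma, provable now): a windowed Weil square is a positive
superposition of Gabor atoms, `W(k(·/a)·(g ⋆ g̃)) = (1/2π) ∫ |ĝ(1/2+iT)|² P_k(a,-T) dT`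
(Fourier inversion `(g⋆g̃)(t) = (1/2π)∫|ĝ(1/2+iT)|² e^{-iTt} dT` inside the continuous linear
functional `W` on `𝓓_{[-ar,ar]}`). -/
theorem superposition (k : ℝ → ℂ) (r : ℝ) (hk : IsWindow k r) {g : ℝ → ℂ} (hg : IsWeilTest g)
    {a : ℝ} (ha : 1 ≤ a) :
    weilFunctional (fun t => k (t / a) * weilConv g (weilReflect g) t) =
      (1 / (2 * Real.pi) : ℂ) *
        ∫ T : ℝ, ((‖weilMellin g (1 / 2 + (T : ℂ) * I)‖ ^ 2 : ℝ) : ℂ) * primeSpectrogram k a (-T) := by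
  sorry

/-- **Superposition, general form** (used by (L2)): for any Weil test `χ`,
`W(k(·/a)·χ) = (1/2π) ∫ χ̂(u) P_k(a,-u) du` with `χ̂(u) = weilMellin χ (1/2 + iu)` (Fourier inversion
of `χ` inside `W`, term by term). The `|ĝ|²` case above is `χ = g ⋆ g̃`. -/
theorem superposition_general (k : ℝ → ℂ) (r : ℝ) (hk : IsWindow k r) {χ : ℝ → ℂ}
    (hχ : IsWeilTest χ) {a : ℝ} (ha : 1 ≤ a) :
    weilFunctional (fun t => k (t / a) * χ t) =
      (1 / (2 * Real.pi) : ℂ) *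
        ∫ u : ℝ, weilMellin χ (1 / 2 + (u : ℂ) * I) * primeSpectrogram k a (-u) := by
  sorry

/-- Every Weil test is a windowed test at a large enough scale: `ψ = k(·/a) · (ψ / k(·/a))` with
`ψ / k(·/a) ∈ C_c^∞` once `tsupport ψ ⊆ (-a r, a r)` (k ≠ 0 there). This is why (L2) needs no limit
`a → ∞` and no Weil criterion. -/
theorem exists_window_factor (k : ℝ → ℂ) (r : ℝ) (hk : IsWindow k r) {ψ : ℝ → ℂ}
    (hψ : IsWeilTest ψ) :
    ∃ (a : ℕ) (χ : ℝ → ℂ), 1 ≤ a ∧ IsWeilTest χ ∧ ∀ t, ψ t = k (t / a) * χ t := by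
  sorry

/-- **Thinning theorem** (first lemma of card `prime-spectrogram`): positivity of the prime
spectrogram of ONE window already gives RH: superposition ⇒ `W(k_a·(g⋆g̃)) ≥ 0`; `a → ∞`
(`k(·/a) → 1` in `C^∞` on `supp (g⋆g̃)`, continuity of `W`) ⇒ `WeilPositivity` ⇒ RH
(`weil_criterion_holds`). -/
theorem riemannHypothesis_of_spectrogramPositivity (k : ℝ → ℂ) (r : ℝ) (hk : IsWindow k r)
    (hpos : SpectrogramPositivity k) : _root_.RiemannHypothesis := by
  sorry

/-- … hence the crux `X` (RH → X is the route's support item `SpectralConverse`, stmt-0193). -/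
theorem spectralThesis_of_spectrogramPositivity (k : ℝ → ℂ) (r : ℝ) (hk : IsWindow k r)
    (hpos : SpectrogramPositivity k)
    (hconv : Summit.RiemannHypothesis.RiemannHypothesis.Theses.SpectralTrace.SpectralConverse) :
    Summit.RiemannHypothesis.RiemannHypothesis.Theses.SpectralTrace.SpectralThesis := by
  sorry

/-- Converse calibration: RH ⇒ spectrogram positivity (each `P_k(a,T)` is a Weil square value;
`WeilPositivity.of_riemannHypothesis`). So `SpectrogramPositivity k ↔ RH` for every window. -/
theorem spectrogramPositivity_of_riemannHypothesis (k : ℝ → ℂ) (r : ℝ) (hk : IsWindow k r)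
    (hRH : _root_.RiemannHypothesis) : SpectrogramPositivity k := by
  sorry

/-- **Energy-local spectral criterion** (first lemma of card `energy-local-operator-criterion`,
also the thinned compactness tool of `prime-spectrogram`): real families `γ^{(j)}` (no relation
between different `j`) with polynomially bounded local counts whose Gabor traces converge,
scale by scale and frequency by frequency, to the prime spectrogram. -/
def LocalSpectralCriterion (k : ℝ → ℂ) : Prop :=
  ∃ (ι : ℕ → Type) (γ : ∀ j, ι j → ℝ),
    (∃ C N : ℝ, ∀ (j : ℕ) (T : ℝ) (s : Finset (ι j)),
        (∀ i ∈ s, |γ j i - T| ≤ 1) → (s.card : ℝ) ≤ C * (1 + |T|) ^ N) ∧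
    ∀ (a : ℕ) (T : ℝ), 1 ≤ a →
      (∀ j, Summable fun i => weilMellin (gaborAtom k a T) (1 / 2 + (γ j i : ℂ) * I)) ∧
      Tendsto (fun j => ∑' i, weilMellin (gaborAtom k a T) (1 / 2 + (γ j i : ℂ) * I)) atTop
        (𝓝 (primeSpectrogram k a T))

/-- `LocalSpectralCriterion → X` (provable now, soft: Helly selection on the counting measures,
integrality of vague limits of ℕ-valued point measures, Fubini `∫ φ(T) P_k(a,T) dT = W(k(·/a)·φ̂)`,
and every Weil test `ψ` is `k(·/a)·χ` with `χ = ψ / k(·/a) ∈ C_c^∞` once `a r > |supp ψ|`).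
No `weil_criterion`, no detour through RH. -/
theorem spectralThesis_of_localSpectralCriterion (k : ℝ → ℂ) (r : ℝ) (hk : IsWindow k r)
    (h : LocalSpectralCriterion k) :
    Summit.RiemannHypothesis.RiemannHypothesis.Theses.SpectralTrace.SpectralThesis := by
  sorry

/-- **Reality for free**: any Hermitian matrix scheme (e.g. Connes–Consani ζ-cycle Dirac operators
`D(λ,k)`, CCM zeta spectral triples `D_log^{(λ,N)}`, Ritz sections of the Weil form) proves `X` as
soon as its Gabor traces converge locally — eigenvalues are real, multiplicities integral. -/
theorem spectralThesis_of_hermitian_scheme (k : ℝ → ℂ) (r : ℝ) (hk : IsWindow k r)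
    (n : ℕ → ℕ) (H : ∀ j, Matrix (Fin (n j)) (Fin (n j)) ℂ) (hH : ∀ j, (H j).IsHermitian)
    (hbound : ∃ C N : ℝ, ∀ (j : ℕ) (T : ℝ) (s : Finset (Fin (n j))),
        (∀ i ∈ s, |(hH j).eigenvalues i - T| ≤ 1) → (s.card : ℝ) ≤ C * (1 + |T|) ^ N)
    (hconv : ∀ (a : ℕ) (T : ℝ), 1 ≤ a →
      Tendsto (fun j => ∑ i, weilMellin (gaborAtom k a T) (1 / 2 + ((hH j).eigenvalues i : ℂ) * I))
        atTop (𝓝 (primeSpectrogram k a T))) :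
    Summit.RiemannHypothesis.RiemannHypothesis.Theses.SpectralTrace.SpectralThesis := by
  sorry

/-- Slice structure (certified rungs): for each fixed scale the spectrogram is eventually positive
in `T` UNCONDITIONALLY (the archimedean term grows like `log |T|`, the prime sum is a bounded
trigonometric polynomial, the polar term decays), so each rung `∀ T, 0 ≤ Re P_k(a,T)` is a
finite-range statement. -/
theorem primeSpectrogram_eventually_pos (k : ℝ → ℂ) (r : ℝ) (hk : IsWindow k r) {a : ℝ}
    (ha : 1 ≤ a) : ∃ T₀ : ℝ, ∀ T : ℝ, T₀ ≤ |T| → 0 < (primeSpectrogram k a T).re := by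
  sorry

end Summit.RiemannHypothesis.RiemannHypothesis.Cruxes.SpectralThesis.Ideator3

end
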